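import Summits.KontsevichZagierPeriods.KontsevichZagierPeriods.Theses.IsogenyCertificates

/-!
# Stub `stub_dupDatum` — the duplication datum
(crux `XMapPeriodTransfer`, stmt-KontsevichZagierPeriods-10665, line `saturated-sign-cells`)

For `y² = P(x) = x³ + Ax + B` the x-map of multiplication by `2` is `f₂/g₂` with
`f₂ = X⁴ − 2AX² − 8BX + A²` and `g₂ = 4P`. We prove that `(f₂, g₂, 2)` is an x-rational isogeny
datum of the crux's shape:

* the Wronskian `W₂ = f₂'g₂ − f₂g₂' = 4X⁶ + 20AX⁴ + 80BX³ − 20A²X² − 16ABX − (4A³ + 32B²)` is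
  non-zero (its `X⁶`-coefficient is `4`);
* the certificate identity `2²·g₂·(f₂³ + A f₂ g₂² + B g₂³) = P·W₂²` (a `ring` identity);
* `IsCoprime f₂ g₂` when `Δ = 4A³ + 27B² ≠ 0`, by the explicit Bezout identity
  `α²·f₂ + (8Xα² + 2αβP' + β²P)·P = (αP' + βP)² = Δ²` with `P' = 3X² + A`,
  `α = −6AX² + 9BX − 4A²`, `β = 18AX − 27B` (using `f₂ = P'² − 8XP` and `αP' + βP = −Δ`);
* the 2-descent inequality `e ≤ f₂(x)/g₂(x)` for every real root `e` of `P` and every real `x`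
  with `P(x) > 0`, from the square identity
  `f₂ − e·g₂ = (x² − 2ex − 2e² − A)² − 4(2x + e)(e³ + Ae + B)`.

The Wronskian, certificate and descent computations are adapted from
`Cruxes/XMapPeriodTransfer/SketchIdeator3.lean`.
-/

open Set Polynomial

namespace Summit.KontsevichZagierPeriods.IsogenyCertificates.XMapPeriodTransferCells

-- adapted from Cruxes/XMapPeriodTransfer/SketchIdeator3.lean (`duplication_wronskian`)
/-- Wronskian of the duplication datum:
`W₂ = 4X⁶ + 20AX⁴ + 80BX³ − 20A²X² − 16ABX − (4A³ + 32B²)` (= `ψ₄/y`). -/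
private theorem stub_dupDatum_wronskian (A B : ℚ) :
    derivative (X ^ 4 - C (2 * A) * X ^ 2 - C (8 * B) * X + C (A ^ 2)) *
        (C 4 * (X ^ 3 + C A * X + C B)) -
      (X ^ 4 - C (2 * A) * X ^ 2 - C (8 * B) * X + C (A ^ 2)) *
        derivative (C 4 * (X ^ 3 + C A * X + C B)) =
    C 4 * X ^ 6 + C (20 * A) * X ^ 4 + C (80 * B) * X ^ 3 - C (20 * A ^ 2) * X ^ 2 -
      C (16 * A * B) * X - C (4 * A ^ 3 + 32 * B ^ 2) := by
  simp only [derivative_sub, derivative_add, derivative_mul, derivative_X_pow, derivative_C,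
    derivative_X, Nat.cast_ofNat, Nat.add_one_sub_one, pow_one, zero_mul, zero_add,
    add_zero, mul_one]
  refine Polynomial.funext fun x => ?_
  simp only [eval_sub, eval_add, eval_mul, eval_pow, eval_C, eval_X]
  ring

-- adapted from Cruxes/XMapPeriodTransfer/SketchIdeator3.lean (`duplication_wronskian_ne_zero`)
/-- The Wronskian `W₂` of the duplication datum is non-zero (its `X⁶`-coefficient is `4`). -/
private theorem stub_dupDatum_wronskian_ne_zero (A B : ℚ) :
    derivative (X ^ 4 - C (2 * A) * X ^ 2 - C (8 * B) * X + C (A ^ 2)) *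
        (C 4 * (X ^ 3 + C A * X + C B)) -
      (X ^ 4 - C (2 * A) * X ^ 2 - C (8 * B) * X + C (A ^ 2)) *
        derivative (C 4 * (X ^ 3 + C A * X + C B)) ≠ 0 := by
  rw [stub_dupDatum_wronskian]
  intro h
  have := congrArg (fun p : ℚ[X] => p.coeff 6) h
  simp only [coeff_add, coeff_sub, coeff_C_mul, coeff_X_pow, coeff_C, coeff_X, coeff_zero] at this
  norm_num at this

-- adapted from Cruxes/XMapPeriodTransfer/SketchIdeator3.lean (`duplication_isDatum`)
/-- The certificate identity of the duplication datum with multiplier `c = 2`: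
`2²·g₂·(f₂³ + A f₂ g₂² + B g₂³) = P·W₂²` (degree `13`, checked by `ring` after evaluation). -/
private theorem stub_dupDatum_isDatum (A B : ℚ) :
    C ((2 : ℚ) ^ 2) * (C 4 * (X ^ 3 + C A * X + C B)) *
      ((X ^ 4 - C (2 * A) * X ^ 2 - C (8 * B) * X + C (A ^ 2)) ^ 3 +
        C A * (X ^ 4 - C (2 * A) * X ^ 2 - C (8 * B) * X + C (A ^ 2)) *
          (C 4 * (X ^ 3 + C A * X + C B)) ^ 2 +
        C B * (C 4 * (X ^ 3 + C A * X + C B)) ^ 3) =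
    (X ^ 3 + C A * X + C B) *
      (derivative (X ^ 4 - C (2 * A) * X ^ 2 - C (8 * B) * X + C (A ^ 2)) *
          (C 4 * (X ^ 3 + C A * X + C B)) -
        (X ^ 4 - C (2 * A) * X ^ 2 - C (8 * B) * X + C (A ^ 2)) *
          derivative (C 4 * (X ^ 3 + C A * X + C B))) ^ 2 := by
  rw [stub_dupDatum_wronskian]
  refine Polynomial.funext fun x => ?_
  simp only [eval_sub, eval_add, eval_mul, eval_pow, eval_C, eval_X]
  ring

/-- Abstract Bezout identity behind the coprimality of the duplication datum: in any commutative
ring, with `P = x³ + ax + b`, `P' = 3x² + a`, `α = −6ax² + 9bx − 4a²`, `β = 18ax − 27b` one has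
`αP' + βP = −(4a³ + 27b²)` and `α²(P'² − 8xP) + (8xα² + 2αβP' + β²P)P = (αP' + βP)²`; so if
`di·(4a³ + 27b²) = 1` and `c4i·c4 = 1` then `di²α²·(P'² − 8xP) + di²(…)c4i·(c4·P) = 1`. -/
private theorem stub_dupDatum_bezout {R : Type*} [CommRing R] (a b x di c4 c4i : R)
    (hdi : di * (4 * a ^ 3 + 27 * b ^ 2) = 1) (h4 : c4i * c4 = 1) :
    di ^ 2 * (-(6 * a * x ^ 2) + 9 * b * x - 4 * a ^ 2) ^ 2 *
        ((3 * x ^ 2 + a) ^ 2 - 8 * x * (x ^ 3 + a * x + b)) +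
      di ^ 2 * (8 * x * (-(6 * a * x ^ 2) + 9 * b * x - 4 * a ^ 2) ^ 2 +
          2 * (-(6 * a * x ^ 2) + 9 * b * x - 4 * a ^ 2) * (18 * a * x - 27 * b) *
            (3 * x ^ 2 + a) +
          (18 * a * x - 27 * b) ^ 2 * (x ^ 3 + a * x + b)) * c4i *
        (c4 * (x ^ 3 + a * x + b)) = 1 := by
  have key : (-(6 * a * x ^ 2) + 9 * b * x - 4 * a ^ 2) * (3 * x ^ 2 + a) +
      (18 * a * x - 27 * b) * (x ^ 3 + a * x + b) = -(4 * a ^ 3 + 27 * b ^ 2) := by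
    ring
  linear_combination
    (di ^ 2 * (8 * x * (-(6 * a * x ^ 2) + 9 * b * x - 4 * a ^ 2) ^ 2 +
          2 * (-(6 * a * x ^ 2) + 9 * b * x - 4 * a ^ 2) * (18 * a * x - 27 * b) *
            (3 * x ^ 2 + a) +
          (18 * a * x - 27 * b) ^ 2 * (x ^ 3 + a * x + b)) * (x ^ 3 + a * x + b)) * h4 +
      (di ^ 2 * ((-(6 * a * x ^ 2) + 9 * b * x - 4 * a ^ 2) * (3 * x ^ 2 + a) +
          (18 * a * x - 27 * b) * (x ^ 3 + a * x + b) - (4 * a ^ 3 + 27 * b ^ 2))) * key +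
      (di * (4 * a ^ 3 + 27 * b ^ 2) + 1) * hdi

/-- Coprimality of the duplication datum of a nonsingular curve: if `4A³ + 27B² ≠ 0` then
`f₂ = X⁴ − 2AX² − 8BX + A²` and `g₂ = 4(X³ + AX + B)` are coprime in `ℚ[X]`. -/
private theorem stub_dupDatum_isCoprime (A B : ℚ) (hΔ : 4 * A ^ 3 + 27 * B ^ 2 ≠ 0) :
    IsCoprime (X ^ 4 - C (2 * A) * X ^ 2 - C (8 * B) * X + C (A ^ 2))
      (C 4 * (X ^ 3 + C A * X + C B)) := by
  have hf : (X ^ 4 - C (2 * A) * X ^ 2 - C (8 * B) * X + C (A ^ 2) : ℚ[X]) =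
      (3 * X ^ 2 + C A) ^ 2 - 8 * X * (X ^ 3 + C A * X + C B) := by
    simp only [map_mul, map_pow, map_ofNat]
    ring
  have hC : (4 * C A ^ 3 + 27 * C B ^ 2 : ℚ[X]) = C (4 * A ^ 3 + 27 * B ^ 2) := by
    simp only [map_add, map_mul, map_pow, map_ofNat]
  have hdi : C (4 * A ^ 3 + 27 * B ^ 2)⁻¹ * (4 * C A ^ 3 + 27 * C B ^ 2 : ℚ[X]) = 1 := by
    rw [hC, ← C_mul, inv_mul_cancel₀ hΔ, C_1]
  have h4 : C (4 : ℚ)⁻¹ * C (4 : ℚ) = 1 := by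
    rw [← C_mul, inv_mul_cancel₀ (by norm_num), C_1]
  rw [hf]
  exact ⟨_, _, stub_dupDatum_bezout (C A) (C B) X (C (4 * A ^ 3 + 27 * B ^ 2)⁻¹) (C 4) (C 4⁻¹)
    hdi h4⟩

-- adapted from Cruxes/XMapPeriodTransfer/SketchIdeator3.lean (`duplication_descent_identity`)
/-- **2-descent square identity** for `y² = x³ + Ax + B`: for every `e`,
`f₂ − e·g₂ = (x² − 2ex − 2e² − A)² − 4(2x + e)·(e³ + Ae + B)`. -/
private theorem stub_dupDatum_descent_identity {R : Type*} [CommRing R] (A B e x : R) :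
    (x ^ 4 - 2 * A * x ^ 2 - 8 * B * x + A ^ 2) - e * (4 * (x ^ 3 + A * x + B)) =
      (x ^ 2 - 2 * e * x - 2 * e ^ 2 - A) ^ 2 - 4 * (2 * x + e) * (e ^ 3 + A * e + B) := by
  ring

-- adapted from Cruxes/XMapPeriodTransfer/SketchIdeator3.lean (`duplication_ge_root`)
/-- On `{P > 0}` the duplication x-map dominates every real root `e` of `P`. -/
private theorem stub_dupDatum_ge_root (A B e x : ℝ) (he : e ^ 3 + A * e + B = 0)
    (hx : 0 < x ^ 3 + A * x + B) :
    e ≤ (x ^ 4 - 2 * A * x ^ 2 - 8 * B * x + A ^ 2) / (4 * (x ^ 3 + A * x + B)) := by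
  rw [le_div_iff₀ (by positivity)]
  have key := stub_dupDatum_descent_identity A B e x
  rw [he, mul_zero, sub_zero] at key
  nlinarith [key, sq_nonneg (x ^ 2 - 2 * e * x - 2 * e ^ 2 - A)]

/-- STUB (D, the duplication datum). `[2]` on `y² = x³ + Ax + B` is a datum `(f₂, g₂, 2)` of the
crux's shape (Wronskian non-zero, certificate identity), coprime when `4A³ + 27B² ≠ 0`, and its x-map
dominates every real root of `P` on `{P > 0}` (2-descent square identity). -/
theorem stub_dupDatum : ∀ (A B : ℤ) (f₂ g₂ : ℚ[X]),
    f₂ = X ^ 4 - C (2 * (A : ℚ)) * X ^ 2 - C (8 * (B : ℚ)) * X + C ((A : ℚ) ^ 2) →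
    g₂ = C 4 * (X ^ 3 + C (A : ℚ) * X + C (B : ℚ)) →
    derivative f₂ * g₂ - f₂ * derivative g₂ ≠ 0 ∧
    C ((2 : ℚ) ^ 2) * g₂ * (f₂ ^ 3 + C (A : ℚ) * f₂ * g₂ ^ 2 + C (B : ℚ) * g₂ ^ 3) =
      (X ^ 3 + C (A : ℚ) * X + C (B : ℚ)) * (derivative f₂ * g₂ - f₂ * derivative g₂) ^ 2 ∧
    (4 * A ^ 3 + 27 * B ^ 2 ≠ 0 → IsCoprime f₂ g₂) ∧
    ∀ e x : ℝ, e ^ 3 + (A : ℝ) * e + (B : ℝ) = 0 → 0 < x ^ 3 + (A : ℝ) * x + (B : ℝ) →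
      e ≤ aeval x f₂ / aeval x g₂ := by
  intro A B f₂ g₂ hf₂ hg₂
  subst hf₂ hg₂
  refine ⟨stub_dupDatum_wronskian_ne_zero (A : ℚ) (B : ℚ), stub_dupDatum_isDatum (A : ℚ) (B : ℚ),
    fun hΔ => stub_dupDatum_isCoprime (A : ℚ) (B : ℚ) (by exact_mod_cast hΔ), ?_⟩
  intro e x he hx
  have h1 : aeval x (X ^ 4 - C (2 * (A : ℚ)) * X ^ 2 - C (8 * (B : ℚ)) * X + C ((A : ℚ) ^ 2)) =
      x ^ 4 - 2 * (A : ℝ) * x ^ 2 - 8 * (B : ℝ) * x + (A : ℝ) ^ 2 := by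
    simp only [map_sub, map_add, map_mul, map_pow, aeval_X, aeval_C, eq_ratCast]
    push_cast
    ring
  have h2 : aeval x (C 4 * (X ^ 3 + C (A : ℚ) * X + C (B : ℚ))) =
      4 * (x ^ 3 + (A : ℝ) * x + (B : ℝ)) := by
    simp only [map_add, map_mul, map_pow, aeval_X, aeval_C, eq_ratCast]
    push_cast
    ring
  rw [h1, h2]
  exact stub_dupDatum_ge_root (A : ℝ) (B : ℝ) e x he hx

end Summit.KontsevichZagierPeriods.IsogenyCertificates.XMapPeriodTransferCells
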